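import Summits.HubbardSuperconductivity.HubbardSuperconductivity.Theorems.JosephsonMirrorPairBridgeGivesGain
import HarnessLib

/-!
# Route `JosephsonMirror`, crux `JmCusp` (stmt-HubbardSuperconductivity-2228), line `Sketch`:
# calibration of the transfer target — Penrose–Onsager order of the `(N_L − 2, 0)` floor gives the zero-mode cusp

`stub_orderGivesCusp`: if, eventually in even `L`, some unit ground state `ψ_L` of `hubbardTorus 2 L 1 U` in the
sector `(N_L − 2, S^z = 0)` has raising pair amplitude `‖Δ_dᴴ ψ_L‖² ≥ a' L⁴` (finite-volume Penrose–Onsager /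
Yang order of the floor, in the raising direction), then the single-layer zero-mode cusp `ZeroModeCusp U δ a' g₀`
(clause C⁺(i) of line `Sketch`, written out) holds for EVERY `g₀`: the variational principle with trial `ψ_L` for
the deformed layer `H − (g/L²) Δ_d Δ_dᴴ` gives `e₂ − e₂(g) ≥ (g/L²) ‖Δ_dᴴψ_L‖² ≥ a' g L²`. Together with the
lead's `stub_dedouble` this sandwiches the open core between S-type finite-volume order and the Josephson gain:
ORDER ⇒ ZeroModeCusp ⇒ JosephsonGain. Koma–Tasaki, J. Stat. Phys. 76 (1994) 745 (LRO ⇒ SSB direction);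
Tasaki (2020) §2.2. No new definitions.
-/

-- the mandated namespace `Summit.<Summit>.<Problem>.Theorems` repeats `HubbardSuperconductivity`
-- (single-problem summit, D-0017), which the `dupNamespace` linter flags on every declaration
set_option linter.dupNamespace false

namespace Summit.HubbardSuperconductivity.HubbardSuperconductivity.Theorems.JosephsonMirror

open Matrix Literature.MathematicalPhysics.QuantumLattice Literature.Probability.LatticeModels
open scoped ComplexOrder

/-- **Stub `stub_orderGivesCusp`** (calibration of the transfer target of line `Sketch`): finite-volume raising
pair order of the `(N_L − 2, S^z = 0)` ground floor, `‖Δ_dᴴ ψ_L‖² ≥ a' L⁴` for some unit ground state and all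
large even `L`, implies the zero-mode cusp `a' g L² ≤ e₂ − e₂(g)` for every `g > 0` (variational principle with
trial `ψ_L`: `e₂(g) ≤ ⟨ψ, (H − (g/L²) Δ Δᴴ) ψ⟩ = e₂ − (g/L²)‖Δᴴψ‖²`). Koma–Tasaki (1994); Tasaki (2020) §2.2.
[folklore] -/
theorem stub_orderGivesCusp :
    ∀ (U δ a' g₀ : ℝ), (∃ L₀ : ℕ, ∀ (L : ℕ) [NeZero L], Even L → L₀ ≤ L → ∃ ψ : Literature.MathematicalPhysics.QuantumLattice.Fock (Literature.MathematicalPhysics.QuantumLattice.Orb (Literature.MathematicalPhysics.QuantumLattice.FermionTorus 2 L)), Literature.MathematicalPhysics.QuantumLattice.IsGroundStateInSector (Literature.MathematicalPhysics.QuantumLattice.hubbardTorus 2 L 1 U) (2 * ⌊(1 - δ) * (L : ℝ) ^ 2 / 2⌋₊ - 2) 0 ψ ∧ star ψ ⬝ᵥ ψ = 1 ∧ a' * (L : ℝ) ^ 4 ≤ (star (Matrix.mulVec (Literature.MathematicalPhysics.QuantumLattice.pairField Literature.MathematicalPhysics.QuantumLattice.dWaveFormFactor L)ᴴ ψ) ⬝ᵥ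 (Matrix.mulVec (Literature.MathematicalPhysics.QuantumLattice.pairField Literature.MathematicalPhysics.QuantumLattice.dWaveFormFactor L)ᴴ ψ)).re) →
    ∀ g ∈ Set.Ioc (0:ℝ) g₀, ∃ L₀ : ℕ, ∀ (L : ℕ) [NeZero L], Even L → L₀ ≤ L → (let ι : Type := Finset (Literature.MathematicalPhysics.QuantumLattice.Orb (Literature.MathematicalPhysics.QuantumLattice.FermionTorus 2 L)); let N : ℕ := 2 * ⌊(1 - δ) * (L : ℝ) ^ 2 / 2⌋₊; let H : Matrix ι ι ℂ := Literature.MathematicalPhysics.QuantumLattice.hubbardTorus 2 L 1 U; let P : Matrix ι ι ℂ := Literature.MathematicalPhysics.QuantumLattice.pairField Literature.MathematicalPhysics.QuantumLattice.dWaveFormFactor L; a' * g * (L : ℝ) ^ 2 ≤ H.minEnergyOn (Literature.MathematicalPhysics.QuantumLattice.szSector (N - 2) 0) - (H - ((g / (L : ℝ) ^ 2 : ℝ) : ℂ) • (P * Pᴴ)).minEnergyOn (Literature.MathematicalPhysics.QuantumLattice.szSector (N - 2) 0)) := by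
  intro U δ a' g₀ hord g hg
  obtain ⟨L₀, hL₀⟩ := hord
  refine ⟨L₀, fun L _ hE hL => ?_⟩
  intro ι N H P
  obtain ⟨ψ, ⟨hψmem, -, hHψ⟩, hψ1, hordL⟩ := hL₀ L hE hL
  have hg0 : 0 < g := hg.1
  have hL0 : (0 : ℝ) < (L : ℝ) := by exact_mod_cast Nat.pos_of_ne_zero (NeZero.ne L)
  have hL20 : (0 : ℝ) < (L : ℝ) ^ 2 := by positivity
  set c : ℝ := g / (L : ℝ) ^ 2 with hc
  set e₂ : ℝ := H.minEnergyOn (szSector (N - 2) 0) with he₂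
  -- Hermitian deformed layer
  have hHerm : (H - (c : ℂ) • (P * Pᴴ)).IsHermitian := by
    have h1 : H.IsHermitian := by
      have := isHermitian_hamiltonianWith (fermionTorusGraph 2 L) 1 U 0
      rwa [show hamiltonianWith (fermionTorusGraph 2 L) 1 U 0 = hubbardTorusWith 2 L 1 U 0 from rfl,
        hubbardTorusWith_zero] at this
    exact h1.sub ((Matrix.isHermitian_mul_conjTranspose_self P).smul (Complex.conj_ofReal c))
  -- the variational bound with trial `ψ`
  have hvar := minEnergyOn_le_rayleigh_of_mem hHerm (szSector (N - 2) 0) hψmem hψ1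
  -- `⟨ψ, (H - c Δ Δᴴ) ψ⟩ = e₂ - c ‖Δᴴ ψ‖²`
  set ξ := Pᴴ *ᵥ ψ with hξ
  have hPP : star ψ ⬝ᵥ ((P * Pᴴ) *ᵥ ψ) = star ξ ⬝ᵥ ξ := by
    rw [← mulVec_mulVec, hξ, star_mulVec, conjTranspose_conjTranspose, ← dotProduct_mulVec]
  have hray : (star ψ ⬝ᵥ ((H - (c : ℂ) • (P * Pᴴ)) *ᵥ ψ)).re = e₂ - c * (star ξ ⬝ᵥ ξ).re := by
    rw [sub_mulVec, smul_mulVec, dotProduct_sub, dotProduct_smul, hHψ, dotProduct_smul, hψ1, hPP,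
      Complex.sub_re, smul_eq_mul, mul_one, Complex.ofReal_re, smul_eq_mul, Complex.re_ofReal_mul]
  rw [hray] at hvar
  -- conclude: `c ‖Δᴴψ‖² ≥ (g/L²) a' L⁴ = a' g L²`
  have hkey : a' * g * (L : ℝ) ^ 2 ≤ c * (star ξ ⬝ᵥ ξ).re := by
    have h1 := mul_le_mul_of_nonneg_left hordL (div_pos hg0 hL20).le
    calc a' * g * (L : ℝ) ^ 2 = g / (L : ℝ) ^ 2 * (a' * (L : ℝ) ^ 4) := by
          field_simp
        _ ≤ g / (L : ℝ) ^ 2 * (star ξ ⬝ᵥ ξ).re := h1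
        _ = c * (star ξ ⬝ᵥ ξ).re := by rw [hc]
  change a' * g * (L : ℝ) ^ 2 ≤ e₂ - (H - (((g / (L : ℝ) ^ 2 : ℝ)) : ℂ) • (P * Pᴴ)).minEnergyOn (szSector (N - 2) 0)
  rw [← hc]
  linarith

end Summit.HubbardSuperconductivity.HubbardSuperconductivity.Theorems.JosephsonMirror
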